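import Mathlib
import Literature.Computability.AlgebraicComplexity.ReadKDeterminantalRepresentationsProofs

/-!
# Crux `ElementaryWordLength.UnboundedReads` (stmt-ValiantsHypothesis-6627), line `SketchIdeator2` —
# stub `stub_universalCount`: universality of `per_n` plus the parameter count

If `n ≥ 2^(b+3)`, `ζ : Fin b → Fin n × Fin n` has distinct rows and distinct columns, and `per_n`
has a *generic form* `D ∈ ℂ[x_e, p_π]` over a finite parameter type `π` — for every substitution `S`
fixing the block variables `x_{ζ i}` and sending every other variable to a constant, `S(per_n)` is
`D` with its parameters evaluated at some point of `ℂ^π` — then `2^b ≤ |π|`.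

Proof (Hrubeš–Joglekar 2025, Thms. 2, 3 and 7, all PROVED in the tree, file
`Literature/Computability/AlgebraicComplexity/ReadKDeterminantalRepresentationsProofs.lean`):
`n ≥ 2^(b+3) ≥ |V b|` (`card_V_le_two_pow`), so by universality (`exists_subst_perPoly_eq`) every
family `c : (Fin b → Bool) → ℂ` of `2^b` coefficients is realised as `S_c(per_n) = Σ_h c_h x^h` by
such a substitution; hence the `2^b` coefficient polynomials `Q_r ∈ ℂ[p_π]` of `D` (coefficients of the
block monomials, `eval_coeff_sumAlgEquiv`, `coeff_sum_C_mul_prod_ite_X`) define a polynomial map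
`ℂ^π → ℂ^(2^b)` whose image is everything, and `card_le_card_of_surjective_eval` gives `2^b ≤ |π|`.
No new definitions.
-/

-- `Summit.ValiantsHypothesis.ValiantsHypothesis.…` is the tree's mandated single-conjunct layout
-- (Sub = Summit), so the duplicated namespace component is intended.
set_option linter.dupNamespace false

open MvPolynomial

namespace Summit.ValiantsHypothesis.ValiantsHypothesis.Theorems.ElementaryWordLengthUnboundedReads

open Literature.Computability.AlgebraicComplexity

/-- **Stub `stub_universalCount` of line `SketchIdeator2` (crux `UnboundedReads`,
stmt-ValiantsHypothesis-6627): universality + parameter count.**  If `n ≥ 2^(b+3)`, the block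
positions `ζ` have distinct rows and distinct columns, and `per_n` has a generic form over the finite
parameter type `π` for the block `ζ`, then `2 ^ b ≤ |π|`. [cite: HrubesJoglekar2025, Thms. 2, 3, 7] -/
theorem stub_universalCount :
    ∀ (n b : ℕ) (ζ : Fin b → Fin n × Fin n), Function.Injective (fun i => (ζ i).1) →
    Function.Injective (fun i => (ζ i).2) → 2 ^ (b + 3) ≤ n →
    ∀ (π : Type) [Fintype π],
      (∃ D : MvPolynomial ((Fin n × Fin n) ⊕ π) ℂ,
        ∀ S : Fin n × Fin n → MvPolynomial (Fin n × Fin n) ℂ,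
          (∀ i, S (ζ i) = MvPolynomial.X (ζ i)) →
          (∀ e, (∀ i, ζ i ≠ e) → ∃ a : ℂ, S e = MvPolynomial.C a) →
          ∃ x : π → ℂ, MvPolynomial.aeval (Sum.elim MvPolynomial.X (fun p => MvPolynomial.C (x p))) D =
            MvPolynomial.aeval S (perPoly (Fin n) ℂ)) →
      2 ^ b ≤ Fintype.card π := by
  intro n b ζ hr hc hn π _ hD
  classical
  obtain ⟨D, hD⟩ := hD
  have hζ : Function.Injective ζ := fun i j h => hr (by simp [h])
  have hV : Fintype.card (ReadOnceTree.V b) ≤ n := le_trans (card_V_le_two_pow b) hn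
  have hF : ringChar ℂ ≠ 2 := by simp [ringChar.eq_zero]
  -- the `2^b` coefficient polynomials of `D` in the parameters
  set Q : (Fin b → Bool) → MvPolynomial π ℂ := fun r =>
    coeff (∑ i ∈ Finset.univ.filter (fun i => r i = true), Finsupp.single (ζ i) 1)
      (sumAlgEquiv ℂ (Fin n × Fin n) π D) with hQdef
  have hQ : ∀ v : (Fin b → Bool) → ℂ, ∃ x : π → ℂ, ∀ r, eval x (Q r) = v r := by
    intro c
    obtain ⟨S, hS₁, hS₂, hS₃⟩ := exists_subst_perPoly_eq hF hV ζ hr hc c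
    obtain ⟨x, hx⟩ := hD S hS₁ hS₂
    refine ⟨x, fun r => ?_⟩
    rw [hQdef, eval_coeff_sumAlgEquiv, hx, hS₃]
    exact coeff_sum_C_mul_prod_ite_X ζ hζ c r
  have hcard := card_le_card_of_surjective_eval Q hQ
  simpa [Fintype.card_fun, Fintype.card_bool, Fintype.card_fin] using hcard

end Summit.ValiantsHypothesis.ValiantsHypothesis.Theorems.ElementaryWordLengthUnboundedReads
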